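import Literature.AlgebraicGeometry.AbelianSchemes.AbelianSchemeAffineBase
import HarnessLib
import Literature.AlgebraicGeometry.AbelianSchemes.AbelianSchemeOverField
import Literature.AlgebraicGeometry.AbelianVarieties.SemiHomogeneousVectorBundle
import Literature.AlgebraicGeometry.Motives.CrystallineRealization
import Literature.AlgebraicGeometry.HodgeTheory.GAGALineBundlesProofs
import Literature.AlgebraicGeometry.Modules.TensorProduct
import Literature.AlgebraicGeometry.Modules.LocalFrames
import Literature.AlgebraicGeometry.Modules.LineBundleOfCocycleClass
import Literature.AlgebraicGeometry.Motives.CartierDivisor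
import Literature.AlgebraicGeometry.ModuliOfAbelianVarieties.SiegelModuliDatum
import Literature.AlgebraicGeometry.Motives.AbelianVarietyWeilPairingAlgClosure
import Literature.AlgebraicGeometry.HodgeTheory.GlobalInvariantCycles      -- ★ `HodgeTheory.IsQuasiProjectiveOver` :69 (B-plan1 g8 word 23:29:40Z)
import Mathlib.AlgebraicGeometry.Morphisms.Smooth                          -- Mathlib smooth morphism class
import Literature.AlgebraicGeometry.ModuliOfAbelianVarieties.SiegelModuliModel   -- ★ M1′ `deligne1971_siegelModuliOnPoints` (+ T1′ `SiegelModuliInterpretation`, `SiegelCanonicalModel`, `SiegelComplexRecordSystem`) — B-plan2 g7 (P)-skeleton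
import Literature.AlgebraicGeometry.ModuliOfAbelianVarieties.SiegelCanonicalReciprocityLevelChange   -- ★ R60-25 `baseChangeEquiv_symm_map` (naturality of `X(ℂ) ≃ (X ⊗ ℂ)(ℂ)`; head glue for `map_pts`) — B-plan2 g7 v0.3
import Literature.AlgebraicGeometry.HodgeTheory.HodgeGenericQbarDescentProofs   -- ★ `IsQuasiProjectiveOver.baseChangeHom` ((F-c′) on the ℂ-side; head glue) — B-plan2 g7 v0.3
import Literature.AlgebraicGeometry.Motives.AlgPointsSeparate   -- ★ `Motives.ext_of_forall_point_eq` (for the ★ P33 paste below; v0.4)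
import Literature.AlgebraicGeometry.ModuliOfAbelianVarieties.SiegelShimuraSetPrincipalDissection   -- ★ R60-27c `exists_eq_mk_jOfSiegel`, `exists_principalRep` (W0 closer, B-p11 g10 3df88ee9) — wlayer v1
import Literature.AlgebraicGeometry.ModuliOfAbelianVarieties.SiegelShimuraSetTransitionDegree   -- ★ `SiegelLevel.N_dvd_N_of_hom` (W1b closer, B-p09 g7 d0aeeada) — wlayer v2
import Literature.AlgebraicGeometry.HodgeTheory.MotivatedClassesDeformation   -- ★ (W1a closer, B-p05 g10 517cd927) — wlayer v4
import Literature.AlgebraicGeometry.Motives.AbelianVarietyProjectiveChart   -- ★ (W1a closer, B-p05 g10 517cd927) — wlayer v4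
import Literature.AlgebraicGeometry.Motives.FiniteCoproductVarieties   -- ★ (W1a closer, B-p05 g10 517cd927) — wlayer v4
import Literature.AlgebraicGeometry.Morphisms.ClopenPieceOfCoproduct   -- ★ (W1a closer, B-p05 g10 517cd927) — wlayer v4
import Literature.NumberTheory.Transcendental.AbelianVarietyAnalyticLieGroup   -- ★ (W1a closer, B-p05 g10 517cd927) — wlayer v4
import Literature.AlgebraicGeometry.Motives.BaseChangeProofs   -- ★ (W1a closer, B-p05 g10 517cd927) — wlayer v4
import Literature.AlgebraicGeometry.ModuliOfAbelianVarieties.SiegelShimuraSetUniformisedPieces   -- ★ (W1a closer, B-p05 g10 517cd927) — wlayer v4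
import Literature.AlgebraicGeometry.ModuliOfAbelianVarieties.SiegelAdelicMarkingTorusPresentation   -- ★ (W1a closer, B-p05 g10 517cd927) — wlayer v4
import Literature.AlgebraicGeometry.ModuliOfAbelianVarieties.SiegelAdelicMarkingRationalMove   -- ★ (T1a) p682640 (B-p05 g10) — replaces the § 3 paste, wlayer v6
import Literature.NumberTheory.Adeles.IntegralAdeleResidue   -- ★ (W4 closer, B-p07 g9 cfbffe98) — wlayer v7
import Literature.AlgebraicGeometry.ModuliOfAbelianVarieties.SiegelAdelicCongrTransport   -- ★ (W4 closer, B-p07 g9 cfbffe98) — wlayer v7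
import Literature.AlgebraicGeometry.Motives.FiberBaseChangePoint   -- ★ p682875 (B-p05 g10) — replaces § 3 §A's public trio, wlayer v9
import Literature.AlgebraicGeometry.AbelianSchemes.AbelianSchemeOverBase   -- ★ D1 p679882 (was pasted)
import Literature.AlgebraicGeometry.AbelianSchemes.AbelianSchemeDualPair   -- ★ D2 p1 p680917 (was pasted)
import Literature.AlgebraicGeometry.AbelianSchemes.AbelianSchemePolarization   -- ★ D2 p2 p681930 (was pasted)
import Literature.AlgebraicGeometry.AbelianSchemes.AbelianSchemeSymplecticLevel   -- ★ D3 p682330 (was pasted)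
import Literature.AlgebraicGeometry.AbelianSchemes.PolarizedAbelianSchemeWithLevel   -- ★ D4 (O)(R) p683764 (B-typ01) (was pasted)
import Literature.AlgebraicGeometry.ModuliOfAbelianVarieties.SiegelFineModuliScheme   -- ★ D4 (M) p684061 (B-typ01) (was pasted)
import Literature.AlgebraicGeometry.AbelianSchemes.AbelianSchemeOverCommOfReduced   -- ★ P33 p680856 (was pasted, v0.4)
import Literature.AlgebraicGeometry.AbelianSchemes.LevelStructureTwist   -- ★ P31 p682878 (was pasted inside § 5)
import Literature.AlgebraicGeometry.AbelianSchemes.LevelStructureTwistBaseChange   -- ★ (N) p683319 (B-p04; was pasted inside § 5)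
import Literature.AlgebraicGeometry.AbelianSchemes.AbelianSchemeOverRestrictPt   -- ★ (B-p04) — § 2's pasted copy dropped in the by-import edition
import Literature.AlgebraicGeometry.AbelianSchemes.AbelianSchemeOverSectionsBaseChange   -- ★ — § 2's pasted copy dropped in the by-import edition
import Literature.AlgebraicGeometry.AbelianSchemes.LevelStructureChangeLevel   -- ★ — § 2's pasted copy dropped in the by-import edition
import Literature.AlgebraicGeometry.ModuliOfAbelianVarieties.SiegelModuliInterpretation   -- (hoisted from the (F)/(U) by-import fact files)
import Literature.AlgebraicGeometry.AbelianSchemes.SymplecticLiftTwist   -- ★ S1 p684100 (B-p07) — § 5 by import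
import Literature.AlgebraicGeometry.ModuliOfAbelianVarieties.SiegelPrincipalLevelSimilitudeTower   -- ★ S2 p684063 (B-p07) — § 5 by import
import Literature.AlgebraicGeometry.ModuliOfAbelianVarieties.SiegelAdelicMarkingConjugateTransport   -- ★ (W3-J) p684655 + §4 p685056 (B-p21 g11) — H2 discharge of the W3 assembly (B-p11 g10)
import Literature.AlgebraicGeometry.AbelianSchemes.AbelianSchemeOverFibreIdentity   -- ★ (c-i)/(c-iv) p682042 (B-p01 g9) — K1 discharge § 7b (B-p11 g10)
import Literature.AlgebraicGeometry.ModuliOfAbelianVarieties.SiegelAdelicMarkingLevelGlue   -- ★ (c-iv-glue) p684288 (B-p20 g5) — K1 discharge § 7b (B-p11 g10)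
import Literature.AlgebraicGeometry.AbelianSchemes.SymplecticLiftReindex   -- ★ (T2) §A p685711 (B-p15 g6) — was pasted (06cf80c7 ll. 2678–2816)
import Literature.AlgebraicGeometry.ModuliOfAbelianVarieties.SiegelReindexTower   -- ★ (T2) §B p686253 (B-p15 g6) — was pasted (06cf80c7 ll. 2818–3224)
import Literature.AlgebraicGeometry.AbelianSchemes.AbelianSchemeDualTransportUnit   -- ★ (c-ii-H) p686114 + p686511 (B-p01 g9) — K2 discharge § 7c (B-p12 g11)
import Literature.AlgebraicGeometry.AbelianSchemes.SymplecticLiftChangeLevel   -- ★ p683953 (B-p09 g7) — § 2 W2 (c5) block re-pointed by import (R16 (c)) — twin v12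
import Literature.AlgebraicGeometry.AbelianSchemes.PolarizedLevelChange   -- ★ p685099 (B-p09 g7) — § 2 W2 `PolarizedAbelianSchemeWithLevel.changeLevel` block re-pointed by import (R16 (c)) — twin v12
import Literature.AlgebraicGeometry.AbelianSchemes.PolarizedAbelianSchemeWithLevelBaseChange   -- ★ p687984 (B-p13 g13) D-BC∃ + H1-core — § 8 `h1R` (B-p11 g11), twin v13
import Literature.AlgebraicGeometry.AbelianSchemes.PolarizedAbelianSchemeRebaseWeilPairing   -- ★ p688745 (B-p11 g11) `hpair` on the re-base — § 8 `h1R`, twin v13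
import Literature.AlgebraicGeometry.AbelianSchemes.AbelianSchemeDualTransportUnique   -- ★ (K3-a) p687970 (B-p12 g11) — § 9 (B-p03 g10)
import Literature.AlgebraicGeometry.AbelianSchemes.AbelianSchemeFibreHom   -- ★ (K3-b) p688194 (B-p15 g6) — § 9
import Literature.AlgebraicGeometry.AbelianSchemes.AbelianSchemeOverFibreDim   -- ★ (K3-d) p687857 (B-p19 g9) — § 9
import Literature.AlgebraicGeometry.AbelianSchemes.AbelianSchemeDualTransportLambda   -- ★ (c-ii-T) (B-p01 g9) — § 9
import Literature.AlgebraicGeometry.AbelianSchemes.AbelianSchemeDualPairSlice   -- ★ (D-1) p685490 (B-p01 g9) — § 9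
import Literature.AlgebraicGeometry.ModuliOfAbelianVarieties.SiegelRebaseTowerProportionality   -- ★ (λ-T) p687729 (B-p21 g11) — § 9
import Literature.AlgebraicGeometry.AbelianVarieties.AbelianVarietyPolarisationRigidity   -- ★ p686566 (B-p03 g10) — § 9
import Literature.AlgebraicGeometry.Motives.AbelianVarietyWeilPairingSimilitudeTowers   -- ★ p682258 + ed.2 p686764 (B-p03) — § 9

/-!
# M1′ from (F) and (U) — E-FU PART 1 of 7 (+ HEAD `M1primeOfFU`): 
§R the five W-texts `StubW0 … StubW4`, the marking predicate `MarkedBy`, the (T1)/(T2) predicates and (T) `MarkedBy.transport`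

Cell hodgecm-mathlib, rung 0 of the Mumford line under `HDel` (item `stmt-HodgeConjecture-24835`).  The E-FU text proves
`deligne1971_siegelModuliOnPoints` (M1′ = [Deligne 1971, 4.16–4.21 on points]) as a THEOREM of the two finer printed facts
(F) `lan2013_siegelFineModuliScheme` [Lan 2013, Thm. 1.4.1.11 + Cor. 7.2.3.9] and (U) `siegelModuli_complexUniformisation`
[MFK94 App. 7A; Deligne 1971, 4.12–4.21; Milne 2005 Thm. 6.11]; it is split into a chain of part files only because of the
400-line cap on proof-bearing `Summits/` files (B-plan1 R22, director s96).  The composition and `theorem M1prime_of_F_U` live in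
the HEAD file `Summits/HodgeConjecture/CorCM/HypDel/M1primeOfFU.lean`; provenance of every § is kept in its banner below and in
HOME `B-plan/lines/m1prime/M1primeOfFU.skeleton.md`.  This part does NOT depend on (F)/(U).
HC_CM is proved only modulo the 7 printed citations until rung 0 closes.
-/

universe u   -- was declared inside the dropped D1 paste
open CategoryTheory CategoryTheory.Limits AlgebraicGeometry MonoidalCategory   -- was a TOP-LEVEL `open` of the dropped D1 paste (and of (M)); the pasted (F)/(U)/partC/§§ rely on it

/- ═════ B-plan2 (g7) — THE (P)-LAYER KERNEL SKELETON `M1primeOfFU` (HOME-only registry PREVIEW «v5.0-shape» of the 24835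
   line `Cruxes/HDel/Lines/F1ExtHodgeType.lean`: {stub_mumford} ↦ {stub_F, stub_U, stub_W0, stub_W1a, stub_W1b, stub_W3, stub_W4};
   nothing registered, no edition, no `crux write`; M1′ stays ONE fact ★ p673894 until E-FU day — director g7 s91 (3)) ═════ -/

/-!
# `M1primeOfFU` v0.4 — (P)-layer skeleton: `(F) → (U) → deligne1971_siegelModuliOnPoints` modulo five named W-witnesses
(closer-§ provenance and fold history: HOME `B-plan/lines/m1prime/M1primeOfFU.skeleton.md` + the by-import twin editions.) -/

noncomputable section

namespace Summit.HodgeConjecture.CorCM.HypDel.M1primeOfFU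

open CategoryTheory CategoryTheory.Limits AlgebraicGeometry
open Literature.AlgebraicGeometry
open Literature.AlgebraicGeometry.Motives (SchemeOver ComplexPoints AlgPoints specOver AbelianVariety CartierDivisor)
open Literature.AlgebraicGeometry.AbelianSchemes (PolarizedAbelianSchemeWithLevel)
open Literature.AlgebraicGeometry.HodgeTheory (IsQuasiProjectiveOver)
open Literature.NumberTheory.Automorphic (siegelUpperHalfSpace)
open Literature.AlgebraicGeometry.ModuliOfAbelianVarieties
open Literature.AlgebraicGeometry.ModuliOfAbelianVarieties.SiegelModuli (jOfSiegel)

/-! ## §R — statement abbreviations (Prop-valued; the registry would record the unfolded signatures) -/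

/-- **`P′` over `Spec ℂ` is MARKED BY `(J, a)`** — (U)'s `IsAdmissibleAt hδ r Z hZ P′` with the point `J(Z)` replaced by an
arbitrary `J ∈ S^±` and the principal representative `r` by an arbitrary `a ∈ GSp_δ(𝔸_f)` (Milne's `η = ū ∘ a`), same binder
order: the fibre of `P′` carries a T1′ marking `m` by `[J, a]`,
an ample witness `Θ` of the polarisation (`IsLambdaOfAt`), and a symplectic lift `Λ` of `(P′.level, Θ)` of type `δ` whose
torsion tower read through `a` (`a⁻¹ v ≡ x/M mod ẑ^{2g}`) IS `m.r`.  [cite: Milne2005ShimuraVarieties, §6 Thm. 6.11 p. 74]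
[cite: Deligne1971TravauxShimura, 4.12 (b) p. 149] -/
def MarkedBy {g N : ℕ} {δ : Fin g → ℕ} (J : C0pm δ) (a : gspFinAdelic δ)
    (P' : PolarizedAbelianSchemeWithLevel g N δ (specOver ℚ ℂ).left) : Prop :=
  ∃ (m : SiegelAdelicMarking J a (P'.A.fibre (𝟙 (Spec (CommRingCat.of ℂ)))).toAbelianVariety)
    (Θ : CartierDivisor (P'.A.fibre (𝟙 (Spec (CommRingCat.of ℂ)))).toAbelianVariety.X.left)
    (Λ : P'.level.SymplecticLift (𝟙 (Spec (CommRingCat.of ℂ))) Θ δ),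
    Θ.IsAmple ∧ P'.A.IsLambdaOfAt (𝟙 (Spec (CommRingCat.of ℂ))) P'.D P'.pol.lam Θ ∧
      ∀ ⦃M : ℕ⦄, N ∣ M → M ≠ 0 → ∀ (x : Fin g ⊕ Fin g → ZMod M) (v : Fin g ⊕ Fin g → ℚ),
        AdelicCongr ((a⁻¹ : gspFinAdelic δ) : GL (Fin g ⊕ Fin g) finAdeleQ) 1 v (fun i => ((x i).val : ℚ) / M) →
          ((Λ.lift M (Multiplicative.ofAdd x)) :
            (P'.A.fibre (𝟙 (Spec (CommRingCat.of ℂ)))).toAbelianVariety.Points ℂ) = m.r v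

/-- **W0 — marked Siegel triples exist over `Spec ℂ`**: for every `0 < g`, polarisation type `δ`, `3 ≤ N` and every class
`[J, a]` (`J ∈ S^±`, `a ∈ GSp_δ(𝔸_f)`) there is a polarised abelian scheme of type `δ` with symplectic-liftable level-`N`
structure over `Spec ℂ` marked by `(J, a)` — AS SOON AS a fine moduli scheme `𝓜` of that level exists (the binder `_𝓜`
is what lets (U) apply; (F) supplies it in the head).  The P27 trap surfaced as a named intermediate (it implies
`Nonempty (PolarizedAbelianSchemeWithLevel g N δ (Spec ℂ))`); it is DERIVED from (U): (U3∃) marks the universal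
fibres of `𝓜` by `(J(Z), r_c)`, and markings transport along `(J, a) ↦ (q·J, q·a·k)`, `q ∈ GSp_δ(ℚ)`, `k ∈ K_δ(N)` (every class has
such a representative, ★ R60-27c).  [cite: Milne2005ShimuraVarieties, §6 Thm. 6.11 p. 74 and proof p. 75, §5 Lemma 5.13 p. 57]
[cite: MumfordFogartyKirwan1994, App. 7A p. 235 (the universal family restricted to `[Z]`)] -/
def StubW0 (g N : ℕ) (δ : Fin g → ℕ) : Prop :=
  0 < g → IsPolarizationType δ → 3 ≤ N →
    ∀ (_𝓜 : SiegelFineModuliScheme g N δ) (J : C0pm δ) (a : gspFinAdelic δ),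
      ∃ P' : PolarizedAbelianSchemeWithLevel g N δ (specOver ℚ ℂ).left, MarkedBy J a P'

/-- **W1a — ONE LEVEL: the complex record data of a fine moduli scheme, with the J1 dictionary.**  For every `0 < g`,
type `δ`, Siegel level `K` and EVERY fine moduli scheme `𝓜` of level `N(K)` (no choice involved): over `𝓜.M ⊗_ℚ ℂ` the
level-`K` fields of ★ `SiegelComplexRecordSystem` — `pts` (R4), pieces / representatives / data / inclusions exhibiting
`𝓜.M ⊗ ℂ` as the coproduct of the piece bases, `incl_unif` (from (U): (U1), (U2+); census rows R7–R11, D1–D16) — TOGETHER WITH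
THE DICTIONARY «`(pts K)⁻¹[J, a]` is the `ℂ`-side classifying point of every `(J, a)`-marked triple of level `N(K)`» (J1/R4:
(U3-D3) at the principal representatives `(J(Z), r_c)` + marking transport along `GSp_δ(ℚ)` / `K_δ(N)` + «isomorphic marked
triples have equal classifying points»).  [cite: Milne2005ShimuraVarieties, §6 Thm. 6.11 p. 74, §5 Lemma 5.13 p. 57]
[cite: MumfordFogartyKirwan1994, App. 7A pp. 234–236] [cite: Deligne1971TravauxShimura, 4.16 p. 150] -/
def StubW1a (g : ℕ) (δ : Fin g → ℕ) : Prop :=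
  0 < g → IsPolarizationType δ →
    ∀ (K : SiegelLevel δ) (𝓜 : SiegelFineModuliScheme g K.N δ),
    haveI : IsLocallyNoetherian (specOver ℚ ℂ).left :=
      inferInstanceAs (IsLocallyNoetherian (Spec (CommRingCat.of ℂ)))
    ∃ (pts : ComplexPoints ((Motives.baseChange ℚ ℂ).obj 𝓜.M) ≃ SiegelShimuraSet δ K.1)
      (Q : Type) (rep : Q → gspFinAdelic δ) (datum : Q → SiegelModuliDatum g δ K.N)
      (incl : ∀ q : Q, (datum q).S ⟶ (Motives.baseChange ℚ ℂ).obj 𝓜.M),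
    -- the pieces ((U1)/(U2+) unpacked: R7–R11, D1–D16)
      Finite Q ∧
      Nonempty (IsColimit (Cofan.mk ((Motives.baseChange ℚ ℂ).obj 𝓜.M) incl)) ∧
      (∀ (q : Q) (Z : Matrix (Fin g) (Fin g) ℂ) (hZ : jOfSiegel δ Z ∈ C0pm δ), Z ∈ siegelUpperHalfSpace g →
          AlgPoints.map (incl q) ((datum q).unif Z) =
            pts.symm (SiegelShimuraSet.mk δ K.1 ⟨jOfSiegel δ Z, hZ⟩ (rep q))) ∧
    -- THE DICTIONARY (J1 / R4), in `ptQ` currency: the `ℚ`-side point under `[J, a]` IS the classifying map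
      (∀ (J : C0pm δ) (a : gspFinAdelic δ) (P' : PolarizedAbelianSchemeWithLevel g K.N δ (specOver ℚ ℂ).left),
        MarkedBy J a P' →
          (AlgPoints.baseChangeEquiv (algebraMap ℚ ℂ) 𝓜.M).symm (pts.symm (SiegelShimuraSet.mk δ K.1 J a)) =
            𝓜.classifyingMap (specOver ℚ ℂ) P')

/-- **W1b — THE TOWER, in marking currency.**  For every `0 < g`, type `δ` and EVERY level-family `K ↦ 𝓜 K` of fine moduli
schemes (no choice involved): `ℚ`-transition maps `tr f : (𝓜 K).M ⟶ (𝓜 K′).M` along `f : K ⟶ K′` (`K ≤ K′`, `N(K′) ∣ N(K)`)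
forming a functor (N8: `tr f := (𝓜 K′).classify` of the level-`N(K)` universal triple re-read at level `N(K′)`; laws by the
`∃!` of `classify`), which send the classifying point of every `(J, a)`-marked triple of level `N(K)` to the classifying point
of some `(J, a)`-marked triple of level `N(K′)` (`tr_marked`: the same abelian scheme and polarisation with the level structure
and its symplectic lift restricted, `σᵢ ↦ (N/N′)·σᵢ`; the marking unchanged).  The statement carries no `changeLevel` token —
that def (D1-adjacent additive module, director g7 2026-08-29T00:04:22Z) lives inside the proof.  ★ `map_pts` is then head
glue (W0 + dictionary at both levels + `tr_marked`).  [cite: MumfordFogartyKirwan1994, App. 7A pp. 235–236 (the tower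
`A_{g,δ,n} → A_{g,δ,m}`, `m ∣ n`)] [cite: Deligne1971TravauxShimura, 4.16 p. 150] [cite: Milne2005ShimuraVarieties, §13 Thm. 13.6
p. 117, §5 p. 56] -/
def StubW1b (g : ℕ) (δ : Fin g → ℕ) : Prop :=
  0 < g → IsPolarizationType δ →
    ∀ (𝓜 : ∀ K : SiegelLevel δ, SiegelFineModuliScheme g K.N δ),
    haveI : IsLocallyNoetherian (specOver ℚ ℂ).left :=
      inferInstanceAs (IsLocallyNoetherian (Spec (CommRingCat.of ℂ)))
    ∃ (tr : ∀ ⦃K K' : SiegelLevel δ⦄, (K ⟶ K') → ((𝓜 K).M ⟶ (𝓜 K').M)),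
    -- N8: the transition maps form a tower
      (∀ K : SiegelLevel δ, tr (𝟙 K) = 𝟙 (𝓜 K).M) ∧
      (∀ ⦃K K' K'' : SiegelLevel δ⦄ (f : K ⟶ K') (f' : K' ⟶ K''), tr (f ≫ f') = tr f ≫ tr f') ∧
    -- `tr_marked`: `[J, aK] ↦ [J, aK′]` in marking currency
      (∀ ⦃K K' : SiegelLevel δ⦄ (f : K ⟶ K') (J : C0pm δ) (a : gspFinAdelic δ)
        (P' : PolarizedAbelianSchemeWithLevel g K.N δ (specOver ℚ ℂ).left), MarkedBy J a P' →
          ∃ P'' : PolarizedAbelianSchemeWithLevel g K'.N δ (specOver ℚ ℂ).left, MarkedBy J a P'' ∧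
            (𝓜 K).classifyingMap (specOver ℚ ℂ) P' ≫ tr f = (𝓜 K').classifyingMap (specOver ℚ ℂ) P'')

/-- **W3 — `IsModuli` AT THE CARRIER** (tower-free, (F)/(U)-free; N6 = C1 + Y1 + I1): for a fine moduli scheme `𝓜` at
level `N`, an automorphism `σ` of `ℂ`, markings `m`, `m′` of abelian varieties `A`, `A′` by `[J, a]`, `[J′, a′]` and a
morphism `f : σA → A′` carrying `σ ∘ η` to `η′ ∘ k` for some `k ∈ K_δ(N)` (★ `SiegelRationalModel.IsModuli` :305 antecedent,
verbatim), `σ` moves the classifying point of any `(J, a)`-marked triple to that of any `(J′, a′)`-marked one (conjugate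
triple = base change along `Spec σ`, `classify` uniqueness, ★ R60-57b `isIso`, R60-58 transport).
[cite: Milne2005ShimuraVarieties, §14 Prop. 14.12 p. 125, §6 Thm. 6.11 p. 74] [cite: Deligne1971TravauxShimura, 4.16–4.17 p. 150] -/
def StubW3 (g N : ℕ) (δ : Fin g → ℕ) : Prop :=
  0 < g → IsPolarizationType δ → 3 ≤ N →
    ∀ (𝓜 : SiegelFineModuliScheme g N δ) (σ : ℂ ≃ₐ[ℚ] ℂ) (J J' : C0pm δ) (a a' : gspFinAdelic δ)
      (A A' : AbelianVariety ℂ) (m : SiegelAdelicMarking J a A) (m' : SiegelAdelicMarking J' a' A')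
      (f : A.conjugate σ.toRingEquiv ⟶ A'),
      (∃ k ∈ principalLevelSubgroup δ N, ∀ v w : Fin g ⊕ Fin g → ℚ,
          AdelicCongr ((k * a⁻¹ : gspFinAdelic δ) : GL (Fin g ⊕ Fin g) finAdeleQ)
              ((a'⁻¹ : gspFinAdelic δ) : GL (Fin g ⊕ Fin g) finAdeleQ) v w →
            AlgPoints.map f.hom.hom.hom (A.conjPoints σ.toRingEquiv (m.r v)) = m'.r w) →
      ∀ (P' P'' : PolarizedAbelianSchemeWithLevel g N δ (specOver ℚ ℂ).left), MarkedBy J a P' → MarkedBy J' a' P'' →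
        haveI : IsLocallyNoetherian (specOver ℚ ℂ).left :=
          inferInstanceAs (IsLocallyNoetherian (Spec (CommRingCat.of ℂ)))
        σ • (𝓜.classifyingMap (specOver ℚ ℂ) P' : AlgPoints 𝓜.M ℂ) = 𝓜.classifyingMap (specOver ℚ ℂ) P''

/-- **W4 — integral Hecke operators AT THE CARRIER** (tower-free, (F)/(U)-free, marking currency; N7): for a fine
moduli scheme `𝓜` at level `N` and `γ ∈ GSp_δ(ẑ) = K_δ(1)` there is ONE `ℚ`-endomorphism `T_γ` of `𝓜.M` which sends the
classifying point of every `(J, a)`-marked triple to the classifying point of some `(J, aγ)`-marked triple (the same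
abelian scheme and polarisation with the level structure twisted by `γ̄_N`; `T_γ := classifyingMap (univ · γ)`, monoid
law by `∃!`).  [cite: MumfordFogartyKirwan1994, App. 7A pp. 235–236 (the `CSp(2g, 𝔸_f)`-action on the tower)]
[cite: Milne2005ShimuraVarieties, §13 Thm. 13.6 p. 117, §6 Thm. 6.11 p. 74]
v0.4 (B-p07 (g9) STATEMENT FINDING 2026-08-29T00:25:14Z, ref2 (g8) ≤-print note 00:26:48Z, repair (r1)): the two
COMMUTATIVITY BINDERS `[IsCommMonObj 𝓜.univ.A.X]`, `[IsCommMonObj P'.A.X]` = [MumfordFogartyKirwan1994, Ch. 6 §1 Cor. 6.5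
(p. 117)] «an abelian scheme is a commutative group scheme», carried as hypotheses ONLY because ★ D1 `AbelianSchemeOver` is
`GrpObj`-valued (≤ print) and the Hecke twist `LevelStructure.twist` (P31) needs `IsCommMonObj`; print-EQUIVALENT to the
un-bindered text.  DISCHARGED IN THE HEAD (never reaching M1′): for (F)'s `𝓜` by ★ P33
`AbelianSchemeOver.isCommMonObj_of_smooth 𝓜.M.hom` (`Smooth 𝓜.M.hom` + `IsSeparated` from `IsQuasiProjectiveOver 𝓜.M`, the
two (F-c′) clauses), for marked triples over `Spec ℂ` by ★ P33 `AbelianSchemeOver.isCommMonObj_of_field`. -/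
def StubW4 (g N : ℕ) (δ : Fin g → ℕ) : Prop :=
  0 < g → IsPolarizationType δ → 3 ≤ N →
    ∀ (𝓜 : SiegelFineModuliScheme g N δ) [IsCommMonObj 𝓜.univ.A.X] (γ : gspFinAdelic δ),
      γ ∈ principalLevelSubgroup δ 1 →
      haveI : IsLocallyNoetherian (specOver ℚ ℂ).left :=
        inferInstanceAs (IsLocallyNoetherian (Spec (CommRingCat.of ℂ)))
      ∃ Tq : 𝓜.M ⟶ 𝓜.M, ∀ (J : C0pm δ) (a : gspFinAdelic δ)
        (P' : PolarizedAbelianSchemeWithLevel g N δ (specOver ℚ ℂ).left) [IsCommMonObj P'.A.X], MarkedBy J a P' →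
          ∃ P'' : PolarizedAbelianSchemeWithLevel g N δ (specOver ℚ ℂ).left, MarkedBy J (a * γ) P'' ∧
            𝓜.classifyingMap (specOver ℚ ℂ) P' ≫ Tq = 𝓜.classifyingMap (specOver ℚ ℂ) P''

/-! ## §S — (E-FU SHAPE PREVIEW) the seven sorried stubs of the skeleton are OMITTED in this edition: (F), (U) enter as the
two named-fact hypotheses of the head; W0, W1a, W1b, W4, (T1), (T2) are theorems of §§ 1–6 below; W3 is the ONE remaining hypothesis. -/

/-! ## §P — plumbing and the kernel-checked composition -/

/- (E-FU shape preview: `siegelModuliOnPoints_of_F_U` / `mumford_of_stubs` of the skeleton are omitted — they consume the sorried stubs.) -/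

end Summit.HodgeConjecture.CorCM.HypDel.M1primeOfFU

end

/-! ═══════════════════════════════════════════════════════════════════════════════════════════════════════════════════
# W0 CLOSER (B-p11 g10, pen of `stub_W0` per B-plan2 (P)-skeleton v0.3 CUT (3), 2026-08-29T00:09:13Z)
(closer-§ provenance and fold history: HOME `B-plan/lines/m1prime/M1primeOfFU.skeleton.md` + the by-import twin editions.) -/

namespace Summit.HodgeConjecture.CorCM.HypDel.M1primeOfFU

open CategoryTheory AlgebraicGeometry
open Literature.AlgebraicGeometry
open Literature.AlgebraicGeometry.Motives (specOver)
open Literature.AlgebraicGeometry.AbelianSchemes (PolarizedAbelianSchemeWithLevel)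
open Literature.NumberTheory.Automorphic (siegelUpperHalfSpace)
open Literature.AlgebraicGeometry.ModuliOfAbelianVarieties
open Literature.AlgebraicGeometry.ModuliOfAbelianVarieties.SiegelModuli (jOfSiegel)

/-- (T1) **left transport of a marking along `GSp_δ(ℚ)`** — the shape W0 consumes (B-p07's `MarkedBy.mulLeft`): a
triple marked by `(J′, r)` is marked by `(γJ′γ⁻¹, γ·r)` for `γ ∈ GSp_δ(ℚ)` (same triple; the marking composed with
`γ⁻¹`; [Milne2005ShimuraVarieties] §5 (5.1), Lemma 5.13). -/
def MarkedByMulLeft (g N : ℕ) (δ : Fin g → ℕ) : Prop :=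
  ∀ (γ : gspRational δ) (J' : C0pm δ) (r : gspFinAdelic δ)
    (P' : PolarizedAbelianSchemeWithLevel g N δ (specOver ℚ ℂ).left),
    MarkedBy J' r P' → MarkedBy (conjAct δ (gspRationalToReal δ γ) J') (gspRationalToFinAdelic δ γ * r) P'

/-- (T2) **right transport of a marking along `K_δ(N)`** — the shape W0 consumes (B-p07's `MarkedBy.translateRight`): a
triple of level `N` marked by `(J, b)` is marked by `(J, b·k)` for `k ∈ K_δ(N)` (same triple; `Λ_{bk} = Λ_b`, the lift
re-matched through `k̄ ≡ 1 (mod N)`; [Milne2005ShimuraVarieties] §6 Thm. 6.11, [Deligne1971TravauxShimura] 4.12 (b)). -/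
def MarkedByTranslateRight (g N : ℕ) (δ : Fin g → ℕ) : Prop :=
  ∀ (k : gspFinAdelic δ), k ∈ principalLevelSubgroup δ N → ∀ (J : C0pm δ) (b : gspFinAdelic δ)
    (P' : PolarizedAbelianSchemeWithLevel g N δ (specOver ℚ ℂ).left),
    MarkedBy J b P' → MarkedBy J (b * k) P'

end Summit.HodgeConjecture.CorCM.HypDel.M1primeOfFU

/-! ## §I (B-p05 g10): (T1) `MarkedBy.mulLeft`, the (T2) text `TranslateRightT`, (T) `MarkedBy.transport` — relocated whole from §I -/

noncomputable section

namespace Summit.HodgeConjecture.CorCM.HypDel.M1primeOfFU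

open CategoryTheory CategoryTheory.Limits Matrix AlgebraicGeometry
open Literature.AlgebraicGeometry.ModuliOfAbelianVarieties
open Literature.AlgebraicGeometry.Motives (SchemeOver ComplexPoints AlgPoints specOver)
open Literature.AlgebraicGeometry.HodgeTheory (IsQuasiProjectiveOver)
open Literature.AlgebraicGeometry.AbelianSchemes (PolarizedAbelianSchemeWithLevel)
open Literature.NumberTheory.Automorphic (siegelUpperHalfSpace)
open SiegelModuli (jOfSiegel)

/-- **(T1) THE RATIONAL MOVE OF A MARKED TRIPLE**: `MarkedBy J a P′ → MarkedBy (qJq⁻¹) (q·a) P′` for every `q ∈ GSp_δ(ℚ)` — same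
triple, same `Θ`, same symplectic lift `Λ`; the marking is moved by `SiegelAdelicMarking.rationalMove`.
[cite: Milne2005ShimuraVarieties, §6 Thm. 6.11 p. 74 and p. 75] [cite: Deligne1971TravauxShimura, 4.11–4.12 pp. 148–149] -/
theorem MarkedBy.mulLeft {g N : ℕ} {δ : Fin g → ℕ} {J : C0pm δ} {a : gspFinAdelic δ}
    {P' : PolarizedAbelianSchemeWithLevel g N δ (specOver ℚ ℂ).left} (q : gspRational δ) (h : MarkedBy J a P') :
    MarkedBy (conjAct δ (gspRationalToReal δ q) J) ((gspRationalToFinAdelic δ q : gspFinAdelic δ) * a) P' := by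
  obtain ⟨m, Θ, Λ, hample, hlam, htower⟩ := h
  refine ⟨m.rationalMove q, Θ, Λ, hample, hlam, fun M hNM hM0 x v hv => ?_⟩
  rw [SiegelAdelicMarking.rationalMove_r]
  exact htower hNM hM0 x _ ((SiegelAdelicMarking.adelicCongr_rationalMove_iff (a := a) q 1 v _).1 hv)

/-- **(T2)'s SIGNATURE** (B-plan2 O2′ 00:22:00Z; owner B-p15): the integral move `k ∈ K_δ(N)` — `MarkedBy J a P′ → MarkedBy J (a·k) P′`
(marking re-based, symplectic lift reindexed by `k̄`).  Taken here as a HYPOTHESIS until its proof lands.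
[cite: Milne2005ShimuraVarieties, §6 p. 75] -/
def TranslateRightT (g N : ℕ) (δ : Fin g → ℕ) : Prop :=
  ∀ {J : C0pm δ} {a : gspFinAdelic δ} {P' : PolarizedAbelianSchemeWithLevel g N δ (specOver ℚ ℂ).left}
    {k : gspFinAdelic δ}, k ∈ principalLevelSubgroup δ N → MarkedBy J a P' → MarkedBy J (a * k) P'

/-- **(T) TRANSPORT OF `MarkedBy` ALONG AN EQUALITY OF SHIMURA-SET CLASSES** (modulo (T2)): if `P′` is marked by `(J, a)` and
`[J, aK_δ(N)] = [J′, a′K_δ(N)]`, then `P′` is marked by `(J′, a′)` — ★ `SiegelShimuraSet.mk_eq_mk_iff` gives `J = γJ′γ⁻¹`,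
`a = γ·a′·k` (`γ ∈ GSp_δ(ℚ)`, `k ∈ K_δ(N)`); apply (T1) with `γ⁻¹` and (T2) with `k⁻¹`.
[cite: Milne2005ShimuraVarieties, §5 (5.1) p. 56 and §6 Thm. 6.11 p. 74] -/
theorem MarkedBy.transport (hT2 : (∀ {g N : ℕ} {δ : Fin g → ℕ}, TranslateRightT g N δ)) {g N : ℕ} {δ : Fin g → ℕ} {J J' : C0pm δ} {a a' : gspFinAdelic δ}
    {P' : PolarizedAbelianSchemeWithLevel g N δ (specOver ℚ ℂ).left} (h : MarkedBy J a P')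
    (heq : SiegelShimuraSet.mk δ (principalLevelSubgroup δ N) J a = SiegelShimuraSet.mk δ (principalLevelSubgroup δ N) J' a') :
    MarkedBy J' a' P' := by
  obtain ⟨γ, hγJ, hγa⟩ := (SiegelShimuraSet.mk_eq_mk_iff δ (principalLevelSubgroup δ N) J J' a a').1 heq
  rw [MulAction.Quotient.smul_coe, QuotientGroup.eq, smul_eq_mul] at hγa
  set k : gspFinAdelic δ := (gspRationalToFinAdelic δ γ * a')⁻¹ * a with hk
  have hkK : k ∈ principalLevelSubgroup δ N := hγa
  -- move by `γ⁻¹`: `(γ⁻¹ • J, γ̂⁻¹ a) = (J′, a′ k)`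
  have h1 := MarkedBy.mulLeft γ⁻¹ h
  have eJ : conjAct δ (gspRationalToReal δ γ⁻¹) J = J' := by
    rw [← hγJ, ← conjAct_mul, ← map_mul, inv_mul_cancel, map_one, conjAct_one]
  have ea : (gspRationalToFinAdelic δ γ⁻¹ : gspFinAdelic δ) * a = a' * k := by
    rw [hk, map_inv]; group
  rw [eJ, ea] at h1
  -- move by `k⁻¹ ∈ K_δ(N)`
  have h2 := hT2 (inv_mem hkK) h1
  rwa [mul_inv_cancel_right] at h2

end Summit.HodgeConjecture.CorCM.HypDel.M1primeOfFU

end
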